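import Summits.Ventures.AbcSig.Rows.Bridge
import Summits.Ventures.AbcSig.Rows.C2aL349A6
import Summits.Ventures.AbcSig.Rows.C2aL349A6AB

/-!
# Venture AbcSig — CELL `C2aL349A6`: the census statement `Rows.C2aCellRed 349 (fun a => 6 ≤ a) {11}` from the two row theorems

HONEST FRAMING. COMPUTATION cell `pub-abcsig`; CONDITIONAL theorem; no claim on ABC or any summit. Hypotheses exactly as in
`Rows/C2aL349A6.lean` / `Rows/C2aL349A6AB.lean` (BS04Package CITED; DataComplete / RefinesCPSymAll / Refines COMPUTED; the rows'
per-orbit CITED exclusions for both family predicates, primed names for `famAB`). Row of record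
`census/rows/C2a/C2a-l349-a6plus.md` (sha16 `395b707e6c317915`). GENERATED by p-lean g4 `gen4/a6row.py` (pattern of `Rows/C2aL307A6XCell.lean`).
-/

namespace Summit.Ventures.AbcSig

/-- Cell `C2aL349A6`: `Rows.C2aCellRed 349 (fun a => 6 ≤ a) {11}` under the rows' hypotheses. -/
theorem xcell_C2aL349A6 (M : NewformModel) (hP : M.BS04Package)
    (hD349 : M.DataComplete 349 level349Orbits) (hCP349 : M.RefinesCPSymAll 349 level349CP)
    (hD698 : M.DataComplete 698 level698Orbits)
    (hX_orbit_349_2 : ∀ n a m : ℕ, n ∈ ([29] : List ℕ) → M.Excludes 349 orbit_349_2 (famB (2 ^ a * 349 ^ m) n (fun _ _ => True)))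
    (hX_orbit_349_2' : ∀ n a m : ℕ, n ∈ ([29] : List ℕ) → M.Excludes 349 orbit_349_2 (famAB (349 ^ m) (2 ^ a) n (fun _ _ => True))) :
    Rows.C2aCellRed 349 (fun a => 6 ≤ a) {11} :=
  C2aCellRed_of_rows 349 (by norm_num) (by norm_num) _ _
    (fun n hn h11 hnℓ hR a m ha han hm hmn x y z h1 h2 =>
      xrow_C2aL349A6 M hP  hD349 hCP349 hD698 n hn h11 hnℓ (by simpa using hR) a m ha hm han hmn (hX_orbit_349_2 n a m) x y z h1 h2)
    (fun n hn h11 hnℓ hR a m ha han hm hmn x y z h1 h2 =>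
      xrow_C2aL349A6AB M hP  hD349 hCP349 hD698 n hn h11 hnℓ (by simpa using hR) a m ha hm han hmn (hX_orbit_349_2' n a m) x y z h1 h2)

end Summit.Ventures.AbcSig
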